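import Mathlib
import Summits.Ventures.PercRepro2.ThreeTypedAll
import Summits.Ventures.PercRepro2.TypedClosed

/-!
# Inert typed edges and oriented labellings (blind cell PercRepro2, night-3, 2026-08-24)

Two reductions of the typed count at a typed edge `e` that never changes a state — the ends of
`e` are already joined once the typed edges are closed (`typedCount_inert_of_conn`), or one end of
`e` lies in a cluster of the closed configuration that carries no mark and no end of another
typed edge (`typedCount_inert_of_alone`): `N_τ = C(3, τ e) · N_{τ[e := 0]}` (`typedCount_inert`,
the support form of `typedCount_loop`).  And the two facts about least-representative labellings
(`TwoTypedBridge.lab`) used to orient the typed edges: a label depends only on the points up to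
its index (`lab_prefix`), and one of the two orientations of a pair of points gives
`lab u ≤ lab w` (`lab_orient`).
-/

namespace Summit.Ventures.PercRepro2

open UnionCluster

namespace CovForm

namespace TwoTyped

open OneTyped TypedRed

/-! ## Inert typed edges -/

section Inert

open Classical

variable {V : Type*} {E : Type*} [Fintype E] [DecidableEq E] {R : Type*} [Field R]
variable (ends : E → Sym2 V) (o a₁ a₂ a₃ b : V)

/-- **An inert typed edge**: if opening `e` changes no state on the support of the count with `e`
pinned closed, then `N_τ = C(3, τ e) · N_{τ[e := 0]}`. -/
theorem typedCount_inert (F : Finset E) (e : E) (he : e ∈ F) (z : Config E) (τ : E → ℕ)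
    (hst : ∀ x : Config E, (∀ e', e' ∉ F.erase e → x e' = Function.update z e false e') →
      st ends o a₁ a₂ a₃ b (Function.update x e true) = st ends o a₁ a₂ a₃ b x) :
    typedCount F z τ (K3 ends o a₁ a₂ a₃ b : Config E → Config E → Config E → R) =
      (Nat.choose 3 (τ e) : R) *
        typedCount F z (Function.update τ e 0) (K3 ends o a₁ a₂ a₃ b) := by
  have hst' : ∀ (x : Config E) (p : Bool),
      (∀ e', e' ∉ F.erase e → x e' = Function.update z e false e') →
      st ends o a₁ a₂ a₃ b (Function.update x e p) = st ends o a₁ a₂ a₃ b x := by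
    intro x p hx
    cases p
    · have hxe : x e = false := by
        rw [hx e (Finset.notMem_erase e F)]; simp
      rw [← hxe, Function.update_eq_self]
    · exact hst x hx
  have hinv : ∀ (p q r : Bool), typedCount (F.erase e) (Function.update z e false) τ
      (fun x y w => (K3 ends o a₁ a₂ a₃ b (Function.update x e p) (Function.update y e q)
        (Function.update w e r) : R)) =
      typedCount (F.erase e) (Function.update z e false) τ
        (fun x y w => (K3 ends o a₁ a₂ a₃ b (Function.update x e false) (Function.update y e false)
          (Function.update w e false) : R)) := by
    intro p q r
    refine typedCount_congr_K_on _ _ _ fun x y w hxyw _ => ?_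
    rw [K3_eq_KB, K3_eq_KB, hst' x p fun e' he' => (hxyw e' he').1,
      hst' y q fun e' he' => (hxyw e' he').2.1, hst' w r fun e' he' => (hxyw e' he').2.2,
      hst' x false fun e' he' => (hxyw e' he').1, hst' y false fun e' he' => (hxyw e' he').2.1,
      hst' w false fun e' he' => (hxyw e' he').2.2]
  rw [typedCount_split F e he, typedCount_split_zero F e he]
  simp only [hinv]
  exact sum_bool3_choose (τ e) _

/-- The closed configuration `z₀` of a typed set: `z` with every edge of `F` closed. -/
def closedOn (F : Finset E) (z : Config E) : Config E := fun e' => if e' ∈ F then false else z e'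

omit [Fintype E] in
/-- Every configuration of the support (agreeing with `z[e := 0]` off `F ∖ {e}`) dominates the
closed configuration. -/
lemma closedOn_le {F : Finset E} {e : E} (he : e ∈ F) {z x : Config E}
    (hx : ∀ e', e' ∉ F.erase e → x e' = Function.update z e false e') : closedOn F z ≤ x := by
  intro e'
  by_cases h : e' ∈ F
  · simp [closedOn, h]
  · have h' : e' ∉ F.erase e := fun h'' => h (Finset.mem_of_mem_erase h'')
    have hne : e' ≠ e := by
      rintro rfl
      exact h he
    simp only [closedOn, h, if_false]
    rw [hx e' h', Function.update_of_ne hne]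

omit [Fintype E] in
/-- The state is unchanged by opening an edge whose ends are joined. -/
lemma st_update_true_of_conn {e : E} {u w : V} (hends : ends e = s(u, w)) (x : Config E)
    (hc : Conn ends x u w) :
    st ends o a₁ a₂ a₃ b (Function.update x e true) = st ends o a₁ a₂ a₃ b x := by
  have key : ∀ p q : V, Conn ends (Function.update x e true) p q ↔ Conn ends x p q := by
    intro p q
    rw [OneEdge.conn_update_true_iff hends]
    constructor
    · rintro (h | ⟨h1, h2⟩ | ⟨h1, h2⟩)
      · exact h
      · exact conn_trans h1 (conn_trans hc h2)
      · exact conn_trans h1 (conn_trans (conn_symm hc) h2)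
    · intro h; exact Or.inl h
  unfold st
  simp only [Prod.mk.injEq]
  exact ⟨decide_eq_decide.mpr (key _ _), decide_eq_decide.mpr (key _ _),
    decide_eq_decide.mpr (key _ _), decide_eq_decide.mpr (key _ _),
    decide_eq_decide.mpr (key _ _), decide_eq_decide.mpr (key _ _),
    decide_eq_decide.mpr (key _ _)⟩

/-- **Joined ends**: a typed edge whose ends are joined once every typed edge is closed is inert. -/
theorem typedCount_inert_of_conn (F : Finset E) (e : E) (he : e ∈ F) {u w : V}
    (hends : ends e = s(u, w)) (z : Config E) (τ : E → ℕ) (hc : Conn ends (closedOn F z) u w) :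
    typedCount F z τ (K3 ends o a₁ a₂ a₃ b : Config E → Config E → Config E → R) =
      (Nat.choose 3 (τ e) : R) *
        typedCount F z (Function.update τ e 0) (K3 ends o a₁ a₂ a₃ b) := by
  refine typedCount_inert ends o a₁ a₂ a₃ b F e he z τ fun x hx => ?_
  exact st_update_true_of_conn ends o a₁ a₂ a₃ b hends x (conn_mono (closedOn_le he hx) hc)

omit [Fintype E] in
/-- The state is unchanged by opening an edge one of whose ends is joined to no mark. -/
lemma st_update_true_of_isolated {e : E} {u w : V} (hends : ends e = s(u, w)) (x : Config E)
    (hu : ∀ m, m = o ∨ m = a₁ ∨ m = a₂ ∨ m = a₃ ∨ m = b → ¬ Conn ends x u m) :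
    st ends o a₁ a₂ a₃ b (Function.update x e true) = st ends o a₁ a₂ a₃ b x := by
  have key : ∀ p q : V, (p = o ∨ p = a₁ ∨ p = a₂ ∨ p = a₃ ∨ p = b) →
      (q = o ∨ q = a₁ ∨ q = a₂ ∨ q = a₃ ∨ q = b) →
      (Conn ends (Function.update x e true) p q ↔ Conn ends x p q) := by
    intro p q hp hq
    rw [OneEdge.conn_update_true_iff hends]
    constructor
    · rintro (h | ⟨h1, h2⟩ | ⟨h1, h2⟩)
      · exact h
      · exact absurd (conn_symm h1) (hu p hp)
      · exact absurd h2 (hu q hq)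
    · intro h; exact Or.inl h
  unfold st
  simp only [Prod.mk.injEq]
  exact ⟨decide_eq_decide.mpr (key _ _ (by simp) (by simp)),
    decide_eq_decide.mpr (key _ _ (by simp) (by simp)),
    decide_eq_decide.mpr (key _ _ (by simp) (by simp)),
    decide_eq_decide.mpr (key _ _ (by simp) (by simp)),
    decide_eq_decide.mpr (key _ _ (by simp) (by simp)),
    decide_eq_decide.mpr (key _ _ (by simp) (by simp)),
    decide_eq_decide.mpr (key _ _ (by simp) (by simp))⟩

omit [Fintype E] in
/-- On the support, the cluster of an end `u` of `e` that no other typed edge touches is its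
cluster in the closed configuration. -/
lemma cluster_eq_closedOn (F : Finset E) (e : E) (he : e ∈ F) {u w : V}
    (hends : ends e = s(u, w)) (z : Config E)
    (hF : ∀ f ∈ F, f ≠ e → ∀ y, y ∈ ends f → ¬ Conn ends (closedOn F z) u y)
    (x : Config E) (hx : ∀ e', e' ∉ F.erase e → x e' = Function.update z e false e') :
    cluster ends x u = cluster ends (closedOn F z) u := by
  refine cluster_eq_of_eqOn_touches (ω := closedOn F z) (ω' := x) ?_ rfl
  intro f hf
  obtain ⟨y, hy, y', hf'⟩ := hf
  simp only [mem_cluster] at hy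
  by_cases hfF : f ∈ F
  · by_cases hfe : f = e
    · subst hfe
      have h1 : x f = false := by
        rw [hx f (Finset.notMem_erase f F)]; simp
      simp [closedOn, hfF, h1]
    · exact absurd hy (hF f hfF hfe y (by rw [hf']; exact Sym2.mem_mk_left y y'))
  · have h' : f ∉ F.erase e := fun h => hfF (Finset.mem_of_mem_erase h)
    have hne : f ≠ e := by
      rintro rfl
      exact hfF he
    simp only [closedOn, hfF, if_false]
    rw [hx f h', Function.update_of_ne hne]

/-- **An isolated end**: a typed edge `e = {u, w}` such that the cluster of `u` in the closed
configuration carries no mark and is touched by no other typed edge is inert. -/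
theorem typedCount_inert_of_alone (F : Finset E) (e : E) (he : e ∈ F) {u w : V}
    (hends : ends e = s(u, w)) (z : Config E) (τ : E → ℕ)
    (hm : ∀ m, m = o ∨ m = a₁ ∨ m = a₂ ∨ m = a₃ ∨ m = b → ¬ Conn ends (closedOn F z) u m)
    (hF : ∀ f ∈ F, f ≠ e → ∀ y, y ∈ ends f → ¬ Conn ends (closedOn F z) u y) :
    typedCount F z τ (K3 ends o a₁ a₂ a₃ b : Config E → Config E → Config E → R) =
      (Nat.choose 3 (τ e) : R) *
        typedCount F z (Function.update τ e 0) (K3 ends o a₁ a₂ a₃ b) := by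
  refine typedCount_inert ends o a₁ a₂ a₃ b F e he z τ fun x hx => ?_
  refine st_update_true_of_isolated ends o a₁ a₂ a₃ b hends x fun m hm' hc => ?_
  have hcl := cluster_eq_closedOn ends F e he hends z hF x hx
  have : m ∈ cluster ends x u := hc
  rw [hcl] at this
  exact hm m hm' this

end Inert

/-! ## Oriented labellings -/

section Orient

open Classical

variable {V : Type*} {E : Type*}
variable (ends : E → Sym2 V) (o a₁ a₂ a₃ b : V)

/-- A label depends only on the points up to its index. -/
lemma lab_prefix (xs ys : List V) (ω : Config E) (i : ℕ)
    (h : ∀ j ≤ i, pt o a₁ a₂ a₃ b xs j = pt o a₁ a₂ a₃ b ys j) :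
    lab ends o a₁ a₂ a₃ b xs ω i = lab ends o a₁ a₂ a₃ b ys ω i := by
  have hs := lab_spec ends o a₁ a₂ a₃ b xs ω i
  have hle := lab_le ends o a₁ a₂ a₃ b xs ω i
  have hmin : ∀ n < lab ends o a₁ a₂ a₃ b xs ω i,
      ¬ Conn ends ω (pt o a₁ a₂ a₃ b xs n) (pt o a₁ a₂ a₃ b xs i) := fun n hn =>
    Nat.find_min (⟨i, conn_refl ends ω (pt o a₁ a₂ a₃ b xs i)⟩ :
      ∃ j, Conn ends ω (pt o a₁ a₂ a₃ b xs j) (pt o a₁ a₂ a₃ b xs i)) hn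
  symm
  refine (Nat.find_eq_iff (⟨i, conn_refl ends ω (pt o a₁ a₂ a₃ b ys i)⟩ :
    ∃ j, Conn ends ω (pt o a₁ a₂ a₃ b ys j) (pt o a₁ a₂ a₃ b ys i))).mpr ⟨?_, ?_⟩
  · rw [← h _ hle, ← h i le_rfl]
    exact hs
  · intro n hn hc
    rw [← h _ (le_trans hn.le hle), ← h i le_rfl] at hc
    exact hmin n hn hc

/-- The points of `pre ++ [A, B]` and `pre ++ [B, A]` agree below the index of `A`. -/
lemma pt_append_pair (pre : List V) (A B : V) (j : ℕ) (hj : j < pre.length + 5) :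
    pt o a₁ a₂ a₃ b (pre ++ [A, B]) j = pt o a₁ a₂ a₃ b (pre ++ [B, A]) j := by
  rcases j with _ | _ | _ | _ | _ | n
  iterate 5 rfl
  simp only [pt]
  have hn : n < pre.length := by omega
  rw [List.getD_eq_getElem?_getD, List.getD_eq_getElem?_getD, List.getElem?_append_left hn,
    List.getElem?_append_left hn]

/-- The point `A` of `pre ++ [A, B]` sits at index `pre.length + 5`. -/
lemma pt_append_pair_self (pre : List V) (A B : V) :
    pt o a₁ a₂ a₃ b (pre ++ [A, B]) (pre.length + 5) = A := by
  show (pre ++ [A, B]).getD pre.length a₁ = A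
  rw [List.getD_eq_getElem?_getD, List.getElem?_append_right le_rfl]
  simp

/-- The point `B` of `pre ++ [A, B]` sits at index `pre.length + 6`. -/
lemma pt_append_pair_snd (pre : List V) (A B : V) :
    pt o a₁ a₂ a₃ b (pre ++ [A, B]) (pre.length + 6) = B := by
  show (pre ++ [A, B]).getD (pre.length + 1) a₁ = B
  rw [List.getD_eq_getElem?_getD, List.getElem?_append_right (by omega)]
  simp

/-- **Orientation**: one of the two orders of a pair of points gives `lab u ≤ lab w`. -/
lemma lab_orient (pre : List V) (A B : V) (ω : Config E) :
    lab ends o a₁ a₂ a₃ b (pre ++ [A, B]) ω (pre.length + 5) ≤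
        lab ends o a₁ a₂ a₃ b (pre ++ [A, B]) ω (pre.length + 6) ∨
      lab ends o a₁ a₂ a₃ b (pre ++ [B, A]) ω (pre.length + 5) ≤
        lab ends o a₁ a₂ a₃ b (pre ++ [B, A]) ω (pre.length + 6) := by
  have key : ∀ A B : V,
      lab ends o a₁ a₂ a₃ b (pre ++ [A, B]) ω (pre.length + 5) ≤
        lab ends o a₁ a₂ a₃ b (pre ++ [B, A]) ω (pre.length + 5) →
      lab ends o a₁ a₂ a₃ b (pre ++ [A, B]) ω (pre.length + 5) ≤
        lab ends o a₁ a₂ a₃ b (pre ++ [A, B]) ω (pre.length + 6) := by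
    intro A B hab
    have hγle : lab ends o a₁ a₂ a₃ b (pre ++ [A, B]) ω (pre.length + 6) ≤ pre.length + 6 :=
      lab_le ends o a₁ a₂ a₃ b (pre ++ [A, B]) ω (pre.length + 6)
    have hαle : lab ends o a₁ a₂ a₃ b (pre ++ [A, B]) ω (pre.length + 5) ≤ pre.length + 5 :=
      lab_le ends o a₁ a₂ a₃ b (pre ++ [A, B]) ω (pre.length + 5)
    rcases Nat.lt_or_ge (lab ends o a₁ a₂ a₃ b (pre ++ [A, B]) ω (pre.length + 6))
        (pre.length + 5) with hlt | hge
    · have hs := lab_spec ends o a₁ a₂ a₃ b (pre ++ [A, B]) ω (pre.length + 6)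
      rw [pt_append_pair_snd, pt_append_pair o a₁ a₂ a₃ b pre A B _ hlt] at hs
      have hmin : lab ends o a₁ a₂ a₃ b (pre ++ [B, A]) ω (pre.length + 5) ≤
          lab ends o a₁ a₂ a₃ b (pre ++ [A, B]) ω (pre.length + 6) := by
        unfold lab
        apply Nat.find_min'
        rw [pt_append_pair_self]
        exact hs
      exact le_trans hab hmin
    · exact le_trans hαle hge
  rcases le_total (lab ends o a₁ a₂ a₃ b (pre ++ [A, B]) ω (pre.length + 5))
      (lab ends o a₁ a₂ a₃ b (pre ++ [B, A]) ω (pre.length + 5)) with h | h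
  · exact Or.inl (key A B h)
  · exact Or.inr (key B A h)

end Orient

end TwoTyped

end CovForm

end Summit.Ventures.PercRepro2
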